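import Literature.Computability.AlgebraicComplexity.LMR13DualVarietiesProofs
import Mathlib.Algebra.MvPolynomial.Nilpotent
import Mathlib.Algebra.Polynomial.Degree.SmallDegree
import Mathlib.FieldTheory.IsAlgClosed.Basic
import HarnessLib

/-!
# LMR13 Lemma 2.4.1 (padding `ℓ^{d−m} R`): refutation of conjunct 1 AS PRINTED

Landsberg–Manivel–Ressayre, *Hypersurfaces with degenerate duals and the geometric complexity
theory program*, Comment. Math. Helv. 88 (2013), Lemma 2.4.1 (p. 474), typed verbatim in the tree as
the named fact `LMR2013_lemma_2_4_1` (`LMR13DualVarieties.lean`): for `R ∈ S^m U^*` irreducible,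
`ℓ ∈ L^*` nonzero, `U^* ⊕ L^* ⊂ W^*` and `P = ℓ^{d−m} R`,
(1) `[R] ∈ Dual_{κ,m,M}` and `[R] ∉ Dual_{κ−1,m,M}` imply `[P] ∈ Dual_{κ,d,N}`, and
(2) `[P] ∉ Dual_{κ−1,d,N}`,
where `Dual_{k,d,N}` (§2.3, p. 474; tree: `dualDegenerateLocus k d`) is the Zariski closure of the set of
IRREDUCIBLE degree-`d` hypersurfaces whose dual variety has dimension `≤ k`.

## What is proved here

* `not_LMR2013_lemma_2_4_1 : ¬ LMR2013_lemma_2_4_1 (σ := Fin 1) (τ := Fin 2)` — conjunct (1) is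
  FALSE as printed (the typed text is faithful to the print): `U = ℂ¹`, `R = u` (`m = 1`, `κ = 0`),
  `d = 2`, `W = ℂ²`, `P = ℓ u`; the lemma puts `[P]` in `Dual_{0,2,2}`, which is EMPTY because a
  binary quadratic form over `ℂ` is never irreducible (`not_irreducible_of_isHomogeneous_two_fin_two`,
  `dualDegenerateLocus_two_fin_two_eq_empty`).  The phenomenon is not an edge case: `ℓ^{d−m} R` is in
  general not a limit of irreducible hypersurfaces with `κ`-dimensional duals (e.g. `ℓ (x²+y²+z²)` is
  not a cubic cone, while `Dual_{1,3,4}` consists of cones).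
* What the printed proof (pp. 474–475, block form of the Hessian) does establish is the statement for
  the zero set `𝒟_{κ,d,N}` of the DIVISIBILITY equations `P ∣ det_{κ+3}(H_P|_F)` — the form in which
  Landsberg, *Geometry and Complexity Theory* (CUP 2017), Prop. 6.5.2.1 (p. 172) restates the lemma and
  the only form used downstream (LMR13 Thm. 1.2.1 = Landsberg Thm. 6.5.2.3; tree
  `LMR2013_thm_1_2_1_holds` does not consume this fact).  That corrected statement is PROVED in the
  sibling file `LMR13PaddingLemma.lean` (`Landsberg2017_prop_6_5_2_1`).

Consequence for the tree: the named fact `LMR2013_lemma_2_4_1` must not be consumed as a hypothesis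
(it has no consumers); conjunct (2) is unaffected by this certificate.

## References
* [LandsbergManivelRessayre2013] J. M. Landsberg, L. Manivel, N. Ressayre, Comment. Math. Helv. 88
  (2013) 469–484, §2.3 (definition of `Dual_{k,d,N}`), Lemma 2.4.1 (p. 474).
* [Landsberg2017] J. M. Landsberg, *Geometry and Complexity Theory*, CUP 2017, §6.5.1–6.5.2,
  Prop. 6.5.2.1 (p. 172).
-/

noncomputable section

open MvPolynomial

namespace Literature.Computability.AlgebraicComplexity

/-- A binary form of degree `2` over `ℂ` is its three-coefficient expansion `a x² + b xy + c y²`.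
[cite: LandsbergManivelRessayre2013, §2.2 (binary forms `P_L`, p. 472)] -/
theorem eq_of_isHomogeneous_two_fin_two {Q : MvPolynomial (Fin 2) ℂ} (hQ : Q.IsHomogeneous 2) :
    Q = C (coeff (Finsupp.single 0 2) Q) * X 0 ^ 2 +
      C (coeff (Finsupp.single 0 1 + Finsupp.single 1 1) Q) * (X 0 * X 1) +
      C (coeff (Finsupp.single 1 2) Q) * X 1 ^ 2 := by
  classical
  rw [X_pow_eq_monomial, X_pow_eq_monomial,
    show (X 0 * X 1 : MvPolynomial (Fin 2) ℂ) = monomial (Finsupp.single 0 1 + Finsupp.single 1 1) 1 by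
      rw [X, X, monomial_mul, mul_one],
    C_mul_monomial, C_mul_monomial, C_mul_monomial, mul_one, mul_one, mul_one]
  refine MvPolynomial.ext _ _ fun μ => ?_
  simp only [coeff_add, coeff_monomial]
  have key : μ = Finsupp.single 0 (μ 0) + Finsupp.single 1 (μ 1) := by
    ext i; fin_cases i <;> simp
  by_cases hw : μ 0 + μ 1 = 2
  · have hμ0 : μ 0 ≤ 2 := by omega
    interval_cases h0 : μ 0
    · have h1 : μ 1 = 2 := by omega
      rw [h1, Finsupp.single_zero, zero_add] at key
      rw [key]
      simp [DFunLike.ext_iff, Fin.forall_fin_two, Finsupp.single_apply]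
    · have h1 : μ 1 = 1 := by omega
      rw [h1] at key
      rw [key]
      simp [DFunLike.ext_iff, Fin.forall_fin_two, Finsupp.single_apply]
    · have h1 : μ 1 = 0 := by omega
      rw [h1, Finsupp.single_zero, add_zero] at key
      rw [key]
      simp [DFunLike.ext_iff, Fin.forall_fin_two, Finsupp.single_apply]
  · have hdeg : μ.degree ≠ 2 := by
      rw [Finsupp.degree_eq_sum, Fin.sum_univ_two]; exact hw
    rw [hQ.coeff_eq_zero hdeg]
    have h0 : ¬ Finsupp.single (0 : Fin 2) 2 = μ := by
      intro h; apply hw; rw [← h]; simp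
    have h1 : ¬ Finsupp.single (0 : Fin 2) 1 + Finsupp.single 1 1 = μ := by
      intro h; apply hw; rw [← h]; simp
    have h2 : ¬ Finsupp.single (1 : Fin 2) 2 = μ := by
      intro h; apply hw; rw [← h]; simp
    rw [if_neg h0, if_neg h1, if_neg h2, add_zero, add_zero]

/-- A binary form with a nonzero coefficient at `x_i` is not a unit of `ℂ[x_0, x_1]`.
[cite: LandsbergManivelRessayre2013, §2.2 (p. 472)] -/
theorem not_isUnit_of_coeff_single_ne_zero {f : MvPolynomial (Fin 2) ℂ} {i : Fin 2}
    (h : coeff (Finsupp.single i 1) f ≠ 0) : ¬ IsUnit f := by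
  classical
  rw [MvPolynomial.isUnit_iff_eq_C_of_isReduced]
  rintro ⟨r, -, rfl⟩
  apply h
  rw [coeff_C, if_neg]
  intro h0
  have := congrArg (fun g => g i) h0
  simp at this

/-- **Binary quadratic forms over `ℂ` are reducible**: `a x² + b xy + c y²` factors into two linear
forms (through a root of `a t² + b t + c` when `a ≠ 0`, the factor `y` otherwise). Hence there is NO
irreducible binary form of degree `2`. [cite: LandsbergManivelRessayre2013, §2.2 (p. 472)] -/
theorem not_irreducible_of_isHomogeneous_two_fin_two {Q : MvPolynomial (Fin 2) ℂ}
    (hQ : Q.IsHomogeneous 2) : ¬ Irreducible Q := by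
  classical
  intro hirr
  set a := coeff (Finsupp.single 0 2) Q with ha
  set b := coeff (Finsupp.single 0 1 + Finsupp.single 1 1) Q with hb
  set c := coeff (Finsupp.single 1 2) Q with hc
  have hQeq : Q = C a * X 0 ^ 2 + C b * (X 0 * X 1) + C c * X 1 ^ 2 :=
    eq_of_isHomogeneous_two_fin_two hQ
  -- coefficient extraction for linear forms `p x + q y`
  have hlin : ∀ (p q : ℂ) (i : Fin 2), coeff (Finsupp.single i 1) (C p * X 0 + C q * X 1) =
      if i = 0 then p else q := by
    intro p q i
    fin_cases i <;> simp [coeff_X, Finsupp.single_eq_single_iff]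
  by_cases ha0 : a = 0
  · -- `Q = y · (b x + c y)`
    have hfac : Q = (C 0 * X 0 + C 1 * X 1) * (C b * X 0 + C c * X 1) := by
      rw [hQeq, ha0]; simp only [map_zero, map_one]; ring
    rcases hirr.isUnit_or_isUnit hfac with hu | hu
    · exact not_isUnit_of_coeff_single_ne_zero (i := 1) (by rw [hlin]; simp) hu
    · by_cases hb0 : b = 0
      · by_cases hc0 : c = 0
        · apply hirr.ne_zero
          rw [hQeq, ha0, hb0, hc0]; simp
        · exact not_isUnit_of_coeff_single_ne_zero (i := 1) (by rw [hlin]; simpa using hc0) hu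
      · exact not_isUnit_of_coeff_single_ne_zero (i := 0) (by rw [hlin]; simpa using hb0) hu
  · -- a root `r` of `a t² + b t + c`, and `Q = (x − r y)(a x + (b + a r) y)`
    obtain ⟨r, hr⟩ := IsAlgClosed.exists_root
      (Polynomial.C a * Polynomial.X ^ 2 + Polynomial.C b * Polynomial.X + Polynomial.C c)
      (by rw [Polynomial.degree_quadratic ha0]; norm_num)
    have hroot : a * r ^ 2 + b * r + c = 0 := by
      simpa [Polynomial.IsRoot] using hr
    have hcr : c = -(a * r ^ 2 + b * r) := by linear_combination hroot
    have hfac : Q = (C 1 * X 0 + C (-r) * X 1) * (C a * X 0 + C (b + a * r) * X 1) := by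
      rw [hQeq, hcr]; simp only [map_neg, map_add, map_mul, map_pow, map_one]; ring
    rcases hirr.isUnit_or_isUnit hfac with hu | hu
    · exact not_isUnit_of_coeff_single_ne_zero (i := 0) (by rw [hlin]; simp) hu
    · exact not_isUnit_of_coeff_single_ne_zero (i := 0) (by rw [hlin]; simpa using ha0) hu

/-- Hence **`Dual_{k,2,2} = ∅`** for every `k`: the generating set of `dualDegenerateLocus k 2` (the
IRREDUCIBLE binary quadratic forms with small dual) is empty, and the Zariski closure of `∅` is `∅`.
[cite: LandsbergManivelRessayre2013, §2.3 (definition of `Dual_{k,d,N}`, p. 474)] -/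
theorem dualDegenerateLocus_two_fin_two_eq_empty (κ : ℕ) :
    dualDegenerateLocus (σ := Fin 2) κ 2 = ∅ := by
  ext P
  simp only [Set.mem_empty_iff_false, iff_false]
  intro hP
  have hgen : {Q : MvPolynomial (Fin 2) ℂ | Q.IsHomogeneous 2 ∧ Irreducible Q ∧ dualVarietyDim Q ≤ κ} =
      ∅ := by
    ext Q
    simp only [Set.mem_setOf_eq, Set.mem_empty_iff_false, iff_false, not_and]
    exact fun hQ hirr _ => not_irreducible_of_isHomogeneous_two_fin_two hQ hirr
  rw [dualDegenerateLocus, Set.mem_setOf_eq, hgen, Set.image_empty, mem_zariskiClosure_iff] at hP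
  have h1 := hP 1 (fun y hy => absurd hy (Set.notMem_empty y))
  simp at h1

/-- **`LMR2013_lemma_2_4_1` is false as typed** — and as printed, for LMR's own `Dual_{k,d,N}` (the
closure of the IRREDUCIBLE hypersurfaces with dual of dimension `≤ k`, §2.3 p. 474): take `U = ℂ¹`,
`R = u` (irreducible, `m = 1`, `Z(R)^*` a point: `κ = 0`; `[R] ∈ Dual_{0,1,1}`, `Dual_{−1} = ∅`),
`d = 2`, `W = ℂ²`, `P = ℓ · u`. The lemma asserts `[P] ∈ Dual_{0,2,2}`; but NO irreducible form of degree
`≥ 2` has a `0`-dimensional dual (such a hypersurface is a hyperplane), and over `W = ℂ²` there is no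
irreducible quadratic form at all, so `Dual_{0,2,2} = ∅`. (The same happens in every ambient
dimension `N`, and for `m = 2`: `P = ℓ · (x² + y² + z²)` is not a cone, while `Dual_{1,3,4}` is the
variety of cubic cones — the irreducible developable cubic surfaces of `ℙ³` are cones.) What the
printed proof (journal pp. 474–475: the block form of `H_P` and "`det_{κ+3}(H_P|_F)` will be a multiple
of `P`") establishes is membership / non-membership in the zero set `𝒟_{κ,d,N}` of the DIVISIBILITY
conditions `P ∣ det(H_P|_F)` — the form in which Landsberg, *Geometry and Complexity Theory* (2017),
Prop. 6.5.2.1 restates the lemma, and the only form used for Thm. 1.2.1 (tree: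
`LMR2013_thm_1_2_1_holds`, which does not consume this fact). Kernel certificate for the cell's erratum
ledger; the named fact must not be consumed as a hypothesis.
[cite: LandsbergManivelRessayre2013, Lemma 2.4.1 (p. 474); Landsberg2017, Prop. 6.5.2.1] -/
theorem not_LMR2013_lemma_2_4_1 : ¬ LMR2013_lemma_2_4_1 (σ := Fin 1) (τ := Fin 2) := by
  intro h
  have hR : (X 0 : MvPolynomial (Fin 1) ℂ).IsHomogeneous 1 := isHomogeneous_X _ _
  have hirr : Irreducible (X 0 : MvPolynomial (Fin 1) ℂ) := (MvPolynomial.X_prime (i := 0)).irreducible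
  let e : Fin 1 ↪ Fin 2 := ⟨fun _ => 1, fun a b _ => Subsingleton.elim a b⟩
  have hℓ : (0 : Fin 2) ∉ Set.range e := by
    rintro ⟨a, ha⟩
    have h10 : (1 : Fin 2) = 0 := ha
    exact absurd h10 (by decide)
  have hmem : (X 0 : MvPolynomial (Fin 1) ℂ) ∈ dualDegenerateLocus (σ := Fin 1) 0 1 :=
    mem_dualDegenerateLocus_of_dualVarietyDim_le hR hirr (dualVarietyDim_of_isHomogeneous_one hR).le
  have hP := (h (X 0) 1 2 0 hR hirr (by norm_num) e 0 hℓ hmem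
    (fun κ' hκ' => absurd hκ' (Nat.not_lt_zero _))).1
  rw [dualDegenerateLocus_two_fin_two_eq_empty] at hP
  exact hP

end Literature.Computability.AlgebraicComplexity
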